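import Summits.KontsevichZagierPeriods.Zeta5Search.WedgeDictionaryQuadratic
import Summits.KontsevichZagierPeriods.Zeta5Search.WedgeDictionaryPFTransfer
import Summits.KontsevichZagierPeriods.Zeta5Search.PolyReflect
import HarnessLib

/-!
# The symmetric ray `b = (3n; n⁷)` of the wedge dictionary: objects and bookkeeping (cell `pub-zeta5`, P1)

HONEST FRAMING: systematic search; no irrationality claim unless certified.

OUR work (Summit side), P1 seat generation 3. On the symmetric ray the very-well-poised dual series is
`F̃₇(3n;n⁷) = Σ_{t≥0} R_n(t)`, `R_n(t) = (2t+3n+2)((t+1)_n (t+2n+2)_n)⁷/((t+1)_{3n+1})⁶ = (2/n!⁴)·h_n(t+n+1)` with `h_n` the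
summand of Zudilin's `r_n` (Mat. Zametki 2002, §2, (7)); its partner `b' = b + e₁ = (3n; n+1, n⁶)` has
`R'_n = (t+n+1)(t+2n+1)R_n = −(2/n!⁴)·h̃_n(t+n+1)` (summand of `r̃_n`). This file fixes the objects and the bookkeeping
used by the transfer files of the ray:

* `bRay n`, `bRay' n`, their box facts, and the EVALUATION of their canonical partial-fraction data (`pfEval_ray`,
  `pfEval_ray'`); the canonical coefficients `U, W, V` (`WedgeDictionary.coeffU/W/V`) of `bRay`, `bRay'` as data sums;
* `toPolyT` — a `Poly2` certificate (`PolyReflect`) as a polynomial in `t` for fixed `n` (for the EXISTENCE of partial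
  fractions of certificates via `CressonFischlerRivoal2008.exists_pf_data`), with `eval` and degree lemmas;
* the constant-term functional `Vfun N K c = Σ_{o<K} Σ_{p≤N} c_{o,p} H_p^{(o+1)}` and its behaviour under padding,
  truncation of orders and the shift `t ↦ t+1` (`Vfun_shiftUp`: it changes by the VALUE of the data at `t = 0` — the
  algebraic form of `Σ_{t≥0}(G(t+1) − G(t)) = −G(0)`), so that telescoping identities transfer to `V` as they do to `U, W`.
-/

noncomputable section

open Finset Polynomial

namespace Summit.KontsevichZagierPeriods.Zeta5Search.SymRay

open Summit.KontsevichZagierPeriods.Zeta5Search.DualSeries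
open Summit.KontsevichZagierPeriods.Zeta5Search.WedgeDictionary
open Summit.KontsevichZagierPeriods.Zeta5Search.PolyReflect
open Literature.NumberTheory.Transcendental
open Literature.NumberTheory.Transcendental.BallRivoal (pfEval pf_unique poch_pos harm pochPoly eval_pochPoly)

/-! ### The ray and its partner -/

/-- Dual parameters of the symmetric ray: `bRay n = (3n; n, n, n, n, n, n, n)` (`= bOfA (n·1⁸)`). -/
def bRay (n : ℕ) : ℕ → ℤ := fun j => if j = 0 then 3 * (n : ℤ) else if j ≤ 7 then (n : ℤ) else 0

/-- The partner `b' = b + e₁ = (3n; n+1, n⁶)`, literally as in the conjecture `wedgeDictionary` (`j = 1`). -/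
def bRay' (n : ℕ) : ℕ → ℤ := Function.update (bRay n) 1 (bRay n 1 + 1)

/-- `(bRay n)₀ = 3n`. -/
@[simp] theorem bRay_zero (n : ℕ) : bRay n 0 = 3 * (n : ℤ) := by simp [bRay]

/-- `(bRay n)_{j+1} = n` for `j < 7`. -/
theorem bRay_succ (n : ℕ) {j : ℕ} (hj : j ∈ range 7) : bRay n (j + 1) = n := by
  have := mem_range.1 hj
  simp [bRay, show j + 1 ≤ 7 by omega]

/-- `(bRay n)₁ = n`. -/
@[simp] theorem bRay_one (n : ℕ) : bRay n 1 = n := bRay_succ n (j := 0) (by simp)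

/-- `(bRay n)₀ = 3n` as a natural number. -/
theorem bRay_zero_toNat (n : ℕ) : (bRay n 0).toNat = 3 * n := by
  rw [bRay_zero, show (3 * (n : ℤ)) = ((3 * n : ℕ) : ℤ) by push_cast; ring, Int.toNat_natCast]

/-- The ray lies in the box. -/
theorem inBox_bRay (n : ℕ) : InBox (bRay n) :=
  ⟨by simp, fun j hj => by rw [bRay_succ n hj, bRay_zero]; omega⟩

/-- `Σ_j b_j = 7n` on the ray. -/
theorem sum_bRay (n : ℕ) : ∑ j ∈ range 7, bRay n (j + 1) = 7 * (n : ℤ) := by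
  rw [sum_congr rfl fun j hj => bRay_succ n hj, sum_const, card_range]; simp

/-- `d(bRay n) = 2n`. -/
theorem dOf_bRay (n : ℕ) : dOf (bRay n) = 2 * (n : ℤ) := by
  rw [dOf, sum_bRay, bRay_zero]; ring

/-- `Σ_j b_j ≤ 3b₀ + 1` on the ray. -/
theorem sum_bRay_le (n : ℕ) : ∑ j ∈ range 7, bRay n (j + 1) ≤ 3 * bRay n 0 + 1 := by
  rw [sum_bRay, bRay_zero]; omega

/-- The canonical data of the ray ARE partial-fraction data of `R_n`. -/
theorem isPFData_ray (n : ℕ) : IsPFData (bRay n) (pfData (bRay n)) :=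
  isPFData_pfData (Classical.choose_spec (exists_isPFData (bRay n) (inBox_bRay n) (sum_bRay_le n)))

/-- `numPoly_{bRay n}(t+1) = (2t+3n+2)((t+1)_n (t+2n+2)_n)⁷`. -/
theorem eval_numPoly_bRay (n : ℕ) (t : ℚ) :
    ((numPoly (bRay n)).comp (X + C 1)).eval t =
      (2 * t + 3 * n + 2) * (BallRivoal.poch (t + 1) n * BallRivoal.poch (t + 2 * n + 2) n) ^ 7 := by
  rw [eval_comp, eval_add, eval_X, eval_C, eval_numPoly, bRay_zero]
  have h : ∀ j ∈ range 7,
      BallRivoal.poch (t + 1) (bRay n (j + 1)).toNat *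
        BallRivoal.poch (t + 1 + ((3 * (n : ℤ) - bRay n (j + 1) + 1 : ℤ) : ℚ)) (bRay n (j + 1)).toNat =
      BallRivoal.poch (t + 1) n * BallRivoal.poch (t + 2 * n + 2) n := fun j hj => by
    rw [bRay_succ n hj, Int.toNat_natCast]
    congr 2
    push_cast; ring
  rw [prod_congr rfl h, prod_const, card_range]
  push_cast; ring

/-- Evaluation of the canonical data of the ray off the poles:
`pfEval = (2t+3n+2)((t+1)_n (t+2n+2)_n)⁷/((t+1)_{3n+1})⁶`. -/
theorem pfEval_ray (n : ℕ) (t : ℚ) (ht : ∀ p, p ≤ 3 * n → t + p + 1 ≠ 0) :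
    pfEval (3 * n) 6 (pfData (bRay n)) t =
      (2 * t + 3 * n + 2) * (BallRivoal.poch (t + 1) n * BallRivoal.poch (t + 2 * n + 2) n) ^ 7 /
        BallRivoal.poch (t + 1) (3 * n + 1) ^ 6 := by
  have h := isPFData_ray n t (by rw [bRay_zero_toNat]; exact ht)
  rw [bRay_zero_toNat, eval_numPoly_bRay] at h
  exact h

/-- `(b')₀ = 3n`. -/
theorem bRay'_zero (n : ℕ) : bRay' n 0 = 3 * (n : ℤ) := by
  rw [bRay', Function.update_of_ne (by norm_num), bRay_zero]

/-- `(b')₀ = 3n` as a natural number. -/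
theorem bRay'_zero_toNat (n : ℕ) : (bRay' n 0).toNat = 3 * n := by
  rw [bRay'_zero, show (3 * (n : ℤ)) = ((3 * n : ℕ) : ℤ) by push_cast; ring, Int.toNat_natCast]

/-- The partner as an update at index `0 + 1` (the form the library lemmas use). -/
theorem bRay'_eq (n : ℕ) : bRay' n = Function.update (bRay n) (0 + 1) (bRay n (0 + 1) + 1) := rfl

/-- The partner lies in the box with `Σ_j b'_j ≤ 3b'₀ + 1`. -/
theorem box_bRay' (n : ℕ) : InBox (bRay' n) ∧ ∑ j ∈ range 7, bRay' n (j + 1) ≤ 3 * bRay' n 0 + 1 := by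
  rw [bRay'_eq]
  exact box_update (bRay n) (inBox_bRay n) (by rw [dOf_bRay]; positivity) (by simp)
    (by rw [Nat.zero_add, bRay_one, bRay_zero]; omega)

/-- The canonical data of the partner ARE partial-fraction data of `R'_n`. -/
theorem isPFData_ray' (n : ℕ) : IsPFData (bRay' n) (pfData (bRay' n)) :=
  isPFData_pfData (Classical.choose_spec (exists_isPFData (bRay' n) (box_bRay' n).1 (box_bRay' n).2))

/-- `numPoly_{b'}(t+1) = (2t+3n+2)((t+1)_n (t+2n+2)_n)⁷ · (t+n+1)(t+2n+1)`. -/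
theorem eval_numPoly_bRay' (n : ℕ) (t : ℚ) :
    ((numPoly (bRay' n)).comp (X + C 1)).eval t =
      (2 * t + 3 * n + 2) * (BallRivoal.poch (t + 1) n * BallRivoal.poch (t + 2 * n + 2) n) ^ 7 *
        ((t + n + 1) * (t + 2 * n + 1)) := by
  have e1 : bRay n (0 + 1) = n := bRay_one n
  rw [bRay'_eq, numPoly_update (bRay n) (i := 0) (by simp) (by rw [e1]; positivity), mul_comp, eval_mul,
    eval_numPoly_bRay, e1, bRay_zero]
  simp only [mul_comp, add_comp, X_comp, C_comp, eval_mul, eval_add, eval_X, eval_C]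
  push_cast; ring

/-- Evaluation of the canonical data of the partner off the poles. -/
theorem pfEval_ray' (n : ℕ) (t : ℚ) (ht : ∀ p, p ≤ 3 * n → t + p + 1 ≠ 0) :
    pfEval (3 * n) 6 (pfData (bRay' n)) t =
      (2 * t + 3 * n + 2) * (BallRivoal.poch (t + 1) n * BallRivoal.poch (t + 2 * n + 2) n) ^ 7 *
          ((t + n + 1) * (t + 2 * n + 1)) / BallRivoal.poch (t + 1) (3 * n + 1) ^ 6 := by
  have h := isPFData_ray' n t (by rw [bRay'_zero_toNat]; exact ht)
  rw [bRay'_zero_toNat, eval_numPoly_bRay'] at h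
  exact h

/-! ### The canonical coefficients as data sums -/

/-- `U(bRay m) = Σ_{p ≤ 3m} c_{4,p}`. -/
theorem coeffU_ray (m : ℕ) : coeffU (bRay m) = ∑ p ∈ range (3 * m + 1), pfData (bRay m) 4 p := by
  rw [coeffU_eq (isPFData_ray m), bRay_zero_toNat]

/-- `W(bRay m) = Σ_{p ≤ 3m} c_{2,p}`. -/
theorem coeffW_ray (m : ℕ) : coeffW (bRay m) = ∑ p ∈ range (3 * m + 1), pfData (bRay m) 2 p := by
  rw [coeffW_eq (isPFData_ray m), bRay_zero_toNat]

/-- `V(bRay m) = Σ_{o<6} Σ_{p ≤ 3m} c_{o,p} H_p^{(o+1)}`. -/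
theorem coeffV_ray (m : ℕ) :
    coeffV (bRay m) = ∑ o ∈ range 6, ∑ p ∈ range (3 * m + 1), pfData (bRay m) o p * harm (o + 1) p := by
  rw [coeffV, bRay_zero_toNat]

/-- `U(bRay' m) = Σ_{p ≤ 3m} c'_{4,p}`. -/
theorem coeffU_ray' (m : ℕ) : coeffU (bRay' m) = ∑ p ∈ range (3 * m + 1), pfData (bRay' m) 4 p := by
  rw [coeffU_eq (isPFData_ray' m), bRay'_zero_toNat]

/-- `W(bRay' m) = Σ_{p ≤ 3m} c'_{2,p}`. -/
theorem coeffW_ray' (m : ℕ) : coeffW (bRay' m) = ∑ p ∈ range (3 * m + 1), pfData (bRay' m) 2 p := by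
  rw [coeffW_eq (isPFData_ray' m), bRay'_zero_toNat]

/-- `V(bRay' m) = Σ_{o<6} Σ_{p ≤ 3m} c'_{o,p} H_p^{(o+1)}`. -/
theorem coeffV_ray' (m : ℕ) :
    coeffV (bRay' m) = ∑ o ∈ range 6, ∑ p ∈ range (3 * m + 1), pfData (bRay' m) o p * harm (o + 1) p := by
  rw [coeffV, bRay'_zero_toNat]

/-! ### Certificates stored as `Poly2` data, read as polynomials in `t` -/

/-- A `Poly2` (rows = coefficients of `t^j`, each a coefficient list in `n`) as a polynomial in `t` at fixed `n`. -/
def toPolyT : Poly2 → ℚ → ℚ[X]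
  | [], _ => 0
  | a :: p, n => C (ev1 a n) + X * toPolyT p n

/-- `eval t (toPolyT p n) = ev2 p n t`. -/
theorem eval_toPolyT : ∀ (p : Poly2) (n t : ℚ), (toPolyT p n).eval t = ev2 p n t
  | [], n, t => by simp [toPolyT]
  | a :: p, n, t => by
    rw [toPolyT, eval_add, eval_C, eval_mul, eval_X, eval_toPolyT p n t, ev2_cons]

/-- `deg_t (toPolyT p n) ≤ #rows`. -/
theorem natDegree_toPolyT_le : ∀ (p : Poly2) (n : ℚ), (toPolyT p n).natDegree ≤ p.length
  | [], n => by simp [toPolyT]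
  | a :: p, n => by
    rw [toPolyT, List.length_cons]
    refine (natDegree_add_le _ _).trans (max_le (by rw [natDegree_C]; omega) ?_)
    refine natDegree_mul_le.trans ?_
    have h1 := natDegree_X_le (R := ℚ)
    have h2 := natDegree_toPolyT_le p n
    omega

/-! ### Truncation of orders and the constant-term functional -/

/-- Reading `K = 6` data with `K = 7`: the truncation `cut` (orders `≥ 6` set to `0`) evaluates the same. -/
theorem pfEval_cut (N : ℕ) (c : ℕ → ℕ → ℚ) (t : ℚ) : pfEval N 7 (cut c) t = pfEval N 6 c t := by
  unfold pfEval
  refine sum_congr rfl fun p _ => ?_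
  rw [sum_range_succ, show cut c 6 p = 0 by simp [cut], zero_div, add_zero]
  exact sum_congr rfl fun o ho => by rw [cut, if_pos (mem_range.1 ho)]

/-- Order sums of truncated data, `o < 6`. -/
theorem sum_cut (N : ℕ) (c : ℕ → ℕ → ℚ) {o : ℕ} (ho : o < 6) :
    ∑ p ∈ range (N + 1), cut c o p = ∑ p ∈ range (N + 1), c o p :=
  sum_congr rfl fun p _ => by rw [cut, if_pos ho]

/-- The constant-term functional `Vfun N K c = Σ_{o<K} Σ_{p≤N} c_{o,p} H_p^{(o+1)}` (so `coeffV b = Vfun b₀ 6 (pfData b)`). -/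
def Vfun (N K : ℕ) (c : ℕ → ℕ → ℚ) : ℚ := ∑ o ∈ range K, ∑ p ∈ range (N + 1), c o p * harm (o + 1) p

/-- `Vfun` of truncated data read with `K = 7`. -/
theorem Vfun_cut (N : ℕ) (c : ℕ → ℕ → ℚ) : Vfun N 7 (cut c) = Vfun N 6 c := by
  unfold Vfun
  rw [sum_range_succ, show ∑ p ∈ range (N + 1), cut c 6 p * harm (6 + 1) p = 0 from
    sum_eq_zero fun p _ => by simp [cut], add_zero]
  exact sum_congr rfl fun o ho => sum_congr rfl fun p _ => by rw [cut, if_pos (mem_range.1 ho)]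

/-- `Vfun` of padded data. -/
theorem Vfun_padData {N M : ℕ} (h : N ≤ M) (K : ℕ) (c : ℕ → ℕ → ℚ) :
    Vfun M K (padData N c) = Vfun N K c := by
  unfold Vfun
  refine sum_congr rfl fun o _ => ?_
  have hsub : range (N + 1) ⊆ range (M + 1) := range_subset_range.2 (by omega)
  rw [← sum_subset hsub]
  · exact sum_congr rfl fun p hp => by rw [padData, if_pos (Nat.lt_succ_iff.1 (mem_range.1 hp))]
  · intro p _ hp
    have hp' : ¬ p ≤ N := fun h' => hp (mem_range.2 (Nat.lt_succ_of_le h'))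
    rw [padData, if_neg hp', zero_mul]

/-- `H_{p+1}^{(i)} = H_p^{(i)} + 1/(p+1)^i`. -/
theorem harm_succ (i p : ℕ) : harm i (p + 1) = harm i p + 1 / ((p : ℚ) + 1) ^ i := by
  rw [harm, harm, sum_range_succ]

/-- **The shift changes the constant-term functional by the value at `t = 0`**:
`Vfun (N+1) K (shiftUp d) = Vfun N K d + pfEval N K d 0`. -/
theorem Vfun_shiftUp (N K : ℕ) (d : ℕ → ℕ → ℚ) :
    Vfun (N + 1) K (shiftUp d) = Vfun N K d + pfEval N K d 0 := by
  unfold Vfun pfEval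
  rw [sum_comm (s := range (N + 1)) (t := range K), ← sum_add_distrib]
  refine sum_congr rfl fun o _ => ?_
  rw [sum_range_succ', ← sum_add_distrib]
  simp only [shiftUp, Nat.add_one_ne_zero, if_false, Nat.add_sub_cancel, if_true, zero_mul, add_zero]
  refine sum_congr rfl fun p _ => ?_
  rw [harm_succ]
  ring

/-- Data vanishing on their support have vanishing `Vfun`. -/
theorem Vfun_eq_zero_of_data {N K : ℕ} {e : ℕ → ℕ → ℚ} (h : ∀ o p, o < K → p ≤ N → e o p = 0) :
    Vfun N K e = 0 :=
  sum_eq_zero fun o ho => sum_eq_zero fun p hp => by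
    rw [h o p (mem_range.1 ho) (Nat.lt_succ_iff.1 (mem_range.1 hp)), zero_mul]

/-- Data evaluating to `0` at every natural `t` vanish on their support (`BallRivoal.pf_unique`). -/
theorem data_eq_zero_of_pfEval_zero (N K : ℕ) (e : ℕ → ℕ → ℚ) (h : ∀ t : ℕ, pfEval N K e t = 0)
    {o p : ℕ} (ho : o < K) (hp : p ≤ N) : e o p = 0 :=
  pf_unique N K e 0 (fun t _ => h t) o p ho hp

/-! ### Pochhammer splitting -/

/-- `(x)_{m+k} = (x)_m (x+m)_k`. -/
theorem poch_add (x : ℚ) (m k : ℕ) : BallRivoal.poch x (m + k) = BallRivoal.poch x m * BallRivoal.poch (x + m) k := by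
  rw [BallRivoal.poch, BallRivoal.poch, BallRivoal.poch, prod_range_add]
  congr 1
  exact prod_congr rfl fun s _ => by push_cast; ring

/-- `(t+1)_{3m+1} = (t+1)_m (t+m+1)_{m+1} (t+2m+2)_m` — the three blocks of the ray's denominator. -/
theorem poch_ray_split (t : ℚ) (m : ℕ) :
    BallRivoal.poch (t + 1) (3 * m + 1) =
      BallRivoal.poch (t + 1) m * BallRivoal.poch (t + m + 1) (m + 1) * BallRivoal.poch (t + 2 * m + 2) m := by
  rw [show 3 * m + 1 = (m + (m + 1)) + m by ring, poch_add, poch_add,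
    show t + 1 + (m : ℚ) = t + m + 1 by ring, show t + 1 + ((m + (m + 1) : ℕ) : ℚ) = t + 2 * m + 2 by push_cast; ring]

end Summit.KontsevichZagierPeriods.Zeta5Search.SymRay
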